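import Summits.KontsevichZagierPeriods.KontsevichZagierPeriods.Theses.IsogenyCertificates
import Summits.KontsevichZagierPeriods.KontsevichZagierPeriods.Theorems.XMapKernel.Negative.Core
import Summits.KontsevichZagierPeriods.KontsevichZagierPeriods.Theorems.IsogenyCertificatesXMapKernelEtaCell
import Literature.NumberTheory.Transcendental.ManyCurveThetaClassification

/-!
# Skeleton — crux `XMapKernel` (stmt-KontsevichZagierPeriods-10663), line `derived-datum-quasi-periods`
(payload slug `line-derived-datum-quasi-periods`; planner's registration-1 skeleton as published in the tree, with
EVERY stub but K closed by the landed theorems — lead prover a2, 2026-08-16).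

Status (lead a2). Lead c1 landed every stub of this line (`Theorems/IsogenyCertificatesXMapKernelStub{DerivedDatum,
WeightedCellMove,HermiteMoveRat,EtaCellCollapse,EtaIndependence(+NonCM,+Aux),CMClassEta(+Aux),EggBridge,
QuasiTransferEngine,QuasiEngineCore/Aux,UnboundedToEgg}.lean`), lead c2 assembled the (ω,η)-egg cell
(`Theorems/IsogenyCertificatesXMapKernelEtaCell.lean`, p117210) conditionally on the named fact
`HuberWustholzManyCurvePeriods`, and that fact is now a THEOREM of the tree (`HuberWustholzManyCurvePeriods_holds`,
`Literature/NumberTheory/Transcendental/ManyCurveThetaClassification.lean`). Below, stubs 1–4 and 6 are closed by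
`exact` on the landed declarations and stub 5 (`stub_etaIndependence`, the transcendence input) by
`XMapKernelEtaCell.etaIndependence HuberWustholzManyCurvePeriods_holds` — UNCONDITIONALLY. The skeleton has EXACTLY
ONE `sorry`: K = `stub_offCellReduction`, and K ↔ `KontsevichZagierPeriods` is an unconditional theorem
(`XMapKernelCells.offCellReduction_iff_summit_holds` in `Theorems/IsogenyCertificatesXMapKernelCellsUnconditional.lean`;
the crux itself ↔ the summit, `XMapKernelIffSummit.xMapKernel_iff_summit`, p116992). What follows is the planner's /
lead c1's record of registration 1.

The line (Ideas/derived-datum-quasi-periods.md): the isogeny ODE `c²·Q(f/g) = P·(f/g)′²` of an x-rational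
isogeny datum `(f, g, c)` from `P = X³+AX+B` to `Q = X³+A′X+B′` already forces the DERIVED DATUM identity

  `c²·f·g + 2·P·(g·g″ − g′²) + P′·g·g′ = (α + β·X)·g²`   (`f, g` coprime; `α, β ∈ ℚ`, `β ≠ 0`),

i.e. `c²·R = α + βx + L(S)` with `R = f/g`, `S = −2g′/g`, `L(S) = P·S′ + ½P′·S` (`L(S)/√P = (S√P)′`): the
pull-back of the quasi-period form `X dX/Y` along the datum is `αω + βη + d(S·y)` with a RATIONAL Hermite
certificate `S` (Elkies' formula, read off the ODE). Consequently quasi-periods ride on the same x-map: for an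
EGG-REGULAR datum between three-real-root curves (`g ≠ 0` on the closed egg) the representations
`[egg′, (b₀ + b₁X)/√Q]` and `[egg, (a₀ + a₁x)/√P]` are KZ-equivalent by the ω-sheets of the sibling crux
`XMapPeriodTransfer` (rule 2 on the monotone cells of the egg, rules 1a/1b) plus ONE rule-3 Hermite move with
primitive `S·√P` (ENGINE). On the (ω, η)-EGG CELL — the subgroup generated by `[egg(A,B), (a₀ + a₁x)/√P]`,
`4A³+27B² < 0`, `a₀, a₁ ∈ ℚ` — every kernel element is then a RELATION outright, given the independence of the
real periods and quasi-periods `Ω_egg, H_egg` of pairwise non-joined curves (transcendence input: Wüstholz /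
Huber–Wüstholz with quasi-periods + twist descent). Off the cell the crux is the period conjecture
(Disproof F1): `stub_offCellReduction` is the crux-sized remainder, carried openly.

Stubs (registration 1): `stub_derivedDatum` (DD, algebra), `stub_weightedCellMove` (rule 2 per egg cell with
weight `b₀ + b₁X`), `stub_hermiteMoveRat` (rule 3 with a rational certificate), `stub_quasiTransferEngine`
(lead: reps exist + the two-way engine from the three previous stubs), `stub_etaCellCollapse` (formal: engine +
independence ⇒ cell kernel ⊆ relations), `stub_etaIndependence` (the transcendence input, to be landed
conditionally on the named fact `HuberWustholzManyCurvePeriods`), `stub_offCellReduction` (K, GPC-strength).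
Disproof.lean (cycle 2) read: F4b honoured (rule 3 used: the Hermite move), F4c honoured (1a at the zeros of W,
1b for (DD)), F1 located in K, F5 consistent (the η-chains are honest relations, not free relators).
-/

noncomputable section

-- work file under `Cruxes/…/Lines`: the prescribed namespace repeats the summit name; silence only that linter.
set_option linter.dupNamespace false

namespace Summit.KontsevichZagierPeriods.KontsevichZagierPeriods.Cruxes.XMapKernel.Lines.DerivedDatumQuasiPeriods

open scoped BigOperators
open Polynomial
open Literature.NumberTheory.Transcendental
open Summit.KontsevichZagierPeriods.KontsevichZagierPeriods.Theses.IsogenyCertificates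
open Set MeasureTheory

/-! ### Stub 1 — the derived datum identity (pure polynomial algebra over `ℚ`) -/

/-- **DD** — the derived datum: for a COPRIME x-rational isogeny datum `(f, g, c)` from the nonsingular
`P = X³+AX+B` to `Q = X³+A′X+B′` (`W = f′g − fg′ ≠ 0`, `c²·g·(f³+A′fg²+B′g³) = P·W²`) one has
`c²·f·g + 2·P·(g·g″ − g′²) + P′·g·g′ = (α + β·X)·g²` with `α, β ∈ ℚ`, `β ≠ 0` (in fact
`β = max(deg f, deg g)`). Local content: every zero of `g` (over `ℚ̄`) is simple and a root of `P`, or double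
and not a root of `P`, with the two leading Laurent coefficients of `f/g` dictated by the ODE (Vélu's
`4P(x₀)/c²`, `2P′(x₀)/c²`); global content: `deg f ≤ deg g + 1`. Calibrations: lemniscate `(X²−1, X, 1)`:
`α = 0, β = 2`; `(X³+4B, X², 1)` (3-isogeny of `y² = x³+B`): `α = 0, β = 3`; its 2-torsion translate
`(3X³+18X²+12, X³−3X²+4, 1)` on `y² = x³+1`: `α = 0, β = 3`. -/
theorem stub_derivedDatum : ∀ (A B A' B' : ℤ) (f g : ℚ[X]) (c : ℚ),
    4 * A ^ 3 + 27 * B ^ 2 ≠ 0 → 4 * A' ^ 3 + 27 * B' ^ 2 ≠ 0 → IsCoprime f g →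
    derivative f * g - f * derivative g ≠ 0 →
    C (c ^ 2) * g * (f ^ 3 + C (A' : ℚ) * f * g ^ 2 + C (B' : ℚ) * g ^ 3) =
      (X ^ 3 + C (A : ℚ) * X + C (B : ℚ)) * (derivative f * g - f * derivative g) ^ 2 →
    ∃ α β : ℚ, β ≠ 0 ∧
      C (c ^ 2) * f * g + C 2 * (X ^ 3 + C (A : ℚ) * X + C (B : ℚ)) *
          (g * derivative (derivative g) - derivative g ^ 2) +
        derivative (X ^ 3 + C (A : ℚ) * X + C (B : ℚ)) * g * derivative g =
      (C α + C β * X) * g ^ 2 :=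
  Summit.KontsevichZagierPeriods.IsogenyCertificates.XMapKernelStubs.DerivedDatum.stub_derivedDatum

/-! ### Stub 2 — rule (2) on one cell of the egg, with the weight `b₀ + b₁X` -/

/-- **Weighted cell move**: on a cell `K = connectedComponentIn L x₀` of the cell locus `L = {P > 0, W ≠ 0}`
on which the real x-map `R = f/g` is injective and pole-free, rule (2) with `Φ = R` transfers
`[K, |c|·(b₀ + b₁R)/√P]` to `[R(K), (b₀ + b₁X)/√Q]`: the Jacobian weight is `|R′|/√Q(R) = |c|/√P` by the ODE
`c²Q(R) = P·R′²`. (The sibling stub `XMapPeriodTransferCells.stub_cellMove` is the case `b₁ = 0`.) -/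
theorem stub_weightedCellMove : ∀ (A B A' B' : ℤ) (f g : ℚ[X]) (c : ℚ),
    derivative f * g - f * derivative g ≠ 0 →
    C (c ^ 2) * g * (f ^ 3 + C (A' : ℚ) * f * g ^ 2 + C (B' : ℚ) * g ^ 3) =
      (X ^ 3 + C (A : ℚ) * X + C (B : ℚ)) * (derivative f * g - f * derivative g) ^ 2 →
    ∀ (R W : ℝ → ℝ) (L : Set ℝ), R = (fun y => aeval y f / aeval y g) →
      W = (fun y => aeval y (derivative f * g - f * derivative g)) →
      L = {y : ℝ | 0 < y ^ 3 + (A : ℝ) * y + (B : ℝ) ∧ W y ≠ 0} →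
    ∀ x₀ ∈ L, InjOn R (connectedComponentIn L x₀) → (∀ y ∈ connectedComponentIn L x₀, aeval y g ≠ 0) →
      ∀ (b₀ b₁ : ℚ) (rI t : KZ.IntegralRep 1),
        rI.domain = {x | x 0 ∈ connectedComponentIn L x₀} →
        EqOn rI.integrand (fun x => |(c : ℝ)| * ((b₀ : ℝ) + (b₁ : ℝ) * R (x 0)) /
          Real.sqrt (x 0 ^ 3 + (A : ℝ) * x 0 + (B : ℝ))) rI.domain →
        t.domain = {x | x 0 ∈ R '' connectedComponentIn L x₀} →
        EqOn t.integrand (fun x => ((b₀ : ℝ) + (b₁ : ℝ) * x 0) /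
          Real.sqrt (x 0 ^ 3 + (A' : ℝ) * x 0 + (B' : ℝ))) t.domain →
        KZ.of rI - KZ.of t ∈ KZ.relations :=
  Summit.KontsevichZagierPeriods.IsogenyCertificates.XMapKernelStubs.WeightedCellMove.stub_weightedCellMove

/-! ### Stub 3 — the Hermite move with a rational certificate -/

/-- **Hermite move with a rational certificate** `S = u/g`, `g ≠ 0` on the closed egg `[e₃, e₂]` of a
three-real-root cubic `P = X³+AX+B`: the representation `[egg, L(S)/√P]`, `L(S) = P·S′ + ½P′·S =
(2P(u′g − ug′) + P′ug)/(2g²)`, is a relation — ONE Newton–Leibniz move over the base point with band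
`[e₃, e₂]` and primitive `F = S·√P` (`ℚ`-semialgebraic; continuous on `[e₃,e₂]`; `F(e₃) = F(e₂) = 0`;
derivative `L(S)/√P` inside), then rule (1a) between the closed and the open egg. (Template:
`HermiteRigidity.HermiteExactFormVanishes`, the case `g = 1`.) -/
theorem stub_hermiteMoveRat : ∀ (A B : ℤ) (u g : ℚ[X]), 4 * A ^ 3 + 27 * B ^ 2 < 0 →
    ∀ (E : Set ℝ), E = {y : ℝ | 0 < y ^ 3 + (A : ℝ) * y + (B : ℝ)} \
      connectedComponentIn {y : ℝ | 0 < y ^ 3 + (A : ℝ) * y + (B : ℝ)} (1 + |(A : ℝ)| + |(B : ℝ)|) →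
    (∀ y ∈ closure E, aeval y g ≠ 0) →
    ∀ r : KZ.IntegralRep 1, r.domain = {x | x 0 ∈ E} →
      EqOn r.integrand (fun x =>
        (2 * (x 0 ^ 3 + (A : ℝ) * x 0 + (B : ℝ)) *
            (aeval (x 0) (derivative u) * aeval (x 0) g - aeval (x 0) u * aeval (x 0) (derivative g)) +
          (3 * x 0 ^ 2 + (A : ℝ)) * aeval (x 0) u * aeval (x 0) g) /
        (2 * (aeval (x 0) g) ^ 2 * Real.sqrt (x 0 ^ 3 + (A : ℝ) * x 0 + (B : ℝ)))) r.domain →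
      KZ.of r ∈ KZ.relations :=
  Summit.KontsevichZagierPeriods.IsogenyCertificates.XMapKernelStubs.HermiteMoveRat.stub_hermiteMoveRat

/-! ### Stub 4 — the (ω, η)-egg cell collapses (formal bookkeeping in `KZ.FormalRep`) -/

/-- **Cell collapse**: if (i) the egg representations `[egg(A,B), (a₀ + a₁x)/√P]` exist, (ii) along every
egg-regular coprime datum the ENGINE transports egg representations both ways, and (iii) the real periods and
quasi-periods `Ω_egg, H_egg` of finitely many three-real-root curves that are pairwise NOT joined by an
egg-regular coprime datum are `ℚ`-linearly independent, then every element of value `0` of the subgroup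
generated by the egg representations is a RELATION: transport every generator to a root curve of its joined
class (each engine step is an equivalence, usable in both directions), merge on each root by rule (1b), read
off the value `∑_roots (pΩ + qH) = 0`, conclude `p = q = 0` by (iii), and discard zero integrands. -/
theorem stub_etaCellCollapse :
    (∀ (A B : ℤ) (a₀ a₁ : ℚ), 4 * A ^ 3 + 27 * B ^ 2 < 0 → ∃ r : KZ.IntegralRep 1,
      r.domain = {x | x 0 ∈ {y : ℝ | 0 < y ^ 3 + (A : ℝ) * y + (B : ℝ)} \
        connectedComponentIn {y : ℝ | 0 < y ^ 3 + (A : ℝ) * y + (B : ℝ)} (1 + |(A : ℝ)| + |(B : ℝ)|)} ∧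
      r.integrand = fun x => ((a₀ : ℝ) + (a₁ : ℝ) * x 0) / Real.sqrt (x 0 ^ 3 + (A : ℝ) * x 0 + (B : ℝ))) →
    (∀ (A B A' B' : ℤ), 4 * A ^ 3 + 27 * B ^ 2 < 0 → 4 * A' ^ 3 + 27 * B' ^ 2 < 0 →
      (∃ (f g : ℚ[X]) (c : ℚ), IsCoprime f g ∧ derivative f * g - f * derivative g ≠ 0 ∧
        C (c ^ 2) * g * (f ^ 3 + C (A' : ℚ) * f * g ^ 2 + C (B' : ℚ) * g ^ 3) =
          (X ^ 3 + C (A : ℚ) * X + C (B : ℚ)) * (derivative f * g - f * derivative g) ^ 2 ∧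
        ∀ y ∈ closure ({y : ℝ | 0 < y ^ 3 + (A : ℝ) * y + (B : ℝ)} \
          connectedComponentIn {y : ℝ | 0 < y ^ 3 + (A : ℝ) * y + (B : ℝ)} (1 + |(A : ℝ)| + |(B : ℝ)|)),
          aeval y g ≠ 0) →
      (∀ b₀ b₁ : ℚ, ∃ a₀ a₁ : ℚ, ∀ (r r' : KZ.IntegralRep 1),
        r.domain = {x | x 0 ∈ {y : ℝ | 0 < y ^ 3 + (A : ℝ) * y + (B : ℝ)} \
          connectedComponentIn {y : ℝ | 0 < y ^ 3 + (A : ℝ) * y + (B : ℝ)} (1 + |(A : ℝ)| + |(B : ℝ)|)} →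
        EqOn r.integrand (fun x => ((a₀ : ℝ) + (a₁ : ℝ) * x 0) /
          Real.sqrt (x 0 ^ 3 + (A : ℝ) * x 0 + (B : ℝ))) r.domain →
        r'.domain = {x | x 0 ∈ {y : ℝ | 0 < y ^ 3 + (A' : ℝ) * y + (B' : ℝ)} \
          connectedComponentIn {y : ℝ | 0 < y ^ 3 + (A' : ℝ) * y + (B' : ℝ)} (1 + |(A' : ℝ)| + |(B' : ℝ)|)} →
        EqOn r'.integrand (fun x => ((b₀ : ℝ) + (b₁ : ℝ) * x 0) /
          Real.sqrt (x 0 ^ 3 + (A' : ℝ) * x 0 + (B' : ℝ))) r'.domain →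
        KZ.Equivalent r r') ∧
      (∀ a₀ a₁ : ℚ, ∃ b₀ b₁ : ℚ, ∀ (r r' : KZ.IntegralRep 1),
        r.domain = {x | x 0 ∈ {y : ℝ | 0 < y ^ 3 + (A : ℝ) * y + (B : ℝ)} \
          connectedComponentIn {y : ℝ | 0 < y ^ 3 + (A : ℝ) * y + (B : ℝ)} (1 + |(A : ℝ)| + |(B : ℝ)|)} →
        EqOn r.integrand (fun x => ((a₀ : ℝ) + (a₁ : ℝ) * x 0) /
          Real.sqrt (x 0 ^ 3 + (A : ℝ) * x 0 + (B : ℝ))) r.domain →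
        r'.domain = {x | x 0 ∈ {y : ℝ | 0 < y ^ 3 + (A' : ℝ) * y + (B' : ℝ)} \
          connectedComponentIn {y : ℝ | 0 < y ^ 3 + (A' : ℝ) * y + (B' : ℝ)} (1 + |(A' : ℝ)| + |(B' : ℝ)|)} →
        EqOn r'.integrand (fun x => ((b₀ : ℝ) + (b₁ : ℝ) * x 0) /
          Real.sqrt (x 0 ^ 3 + (A' : ℝ) * x 0 + (B' : ℝ))) r'.domain →
        KZ.Equivalent r r')) →
    (∀ (k : ℕ) (A B : Fin k → ℤ) (p q : Fin k → ℚ), (∀ i, 4 * A i ^ 3 + 27 * B i ^ 2 < 0) →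
      (∀ i j, i ≠ j → ¬ ∃ (f g : ℚ[X]) (c : ℚ), IsCoprime f g ∧ derivative f * g - f * derivative g ≠ 0 ∧
        C (c ^ 2) * g * (f ^ 3 + C (A j : ℚ) * f * g ^ 2 + C (B j : ℚ) * g ^ 3) =
          (X ^ 3 + C (A i : ℚ) * X + C (B i : ℚ)) * (derivative f * g - f * derivative g) ^ 2 ∧
        ∀ y ∈ closure ({y : ℝ | 0 < y ^ 3 + (A i : ℝ) * y + (B i : ℝ)} \
          connectedComponentIn {y : ℝ | 0 < y ^ 3 + (A i : ℝ) * y + (B i : ℝ)} (1 + |(A i : ℝ)| + |(B i : ℝ)|)),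
          aeval y g ≠ 0) →
      ∑ i, ((p i : ℝ) * (∫ x in {x : Fin 1 → ℝ | x 0 ∈ {y : ℝ | 0 < y ^ 3 + (A i : ℝ) * y + (B i : ℝ)} \
          connectedComponentIn {y : ℝ | 0 < y ^ 3 + (A i : ℝ) * y + (B i : ℝ)} (1 + |(A i : ℝ)| + |(B i : ℝ)|)},
          1 / Real.sqrt (x 0 ^ 3 + (A i : ℝ) * x 0 + (B i : ℝ))) +
        (q i : ℝ) * (∫ x in {x : Fin 1 → ℝ | x 0 ∈ {y : ℝ | 0 < y ^ 3 + (A i : ℝ) * y + (B i : ℝ)} \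
          connectedComponentIn {y : ℝ | 0 < y ^ 3 + (A i : ℝ) * y + (B i : ℝ)} (1 + |(A i : ℝ)| + |(B i : ℝ)|)},
          x 0 / Real.sqrt (x 0 ^ 3 + (A i : ℝ) * x 0 + (B i : ℝ)))) = 0 →
      ∀ i, p i = 0 ∧ q i = 0) →
    ∀ c ∈ AddSubgroup.closure {d : KZ.FormalRep | ∃ (A B : ℤ) (a₀ a₁ : ℚ) (r : KZ.IntegralRep 1),
        4 * A ^ 3 + 27 * B ^ 2 < 0 ∧
        r.domain = {x | x 0 ∈ {y : ℝ | 0 < y ^ 3 + (A : ℝ) * y + (B : ℝ)} \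
          connectedComponentIn {y : ℝ | 0 < y ^ 3 + (A : ℝ) * y + (B : ℝ)} (1 + |(A : ℝ)| + |(B : ℝ)|)} ∧
        EqOn r.integrand (fun x => ((a₀ : ℝ) + (a₁ : ℝ) * x 0) /
          Real.sqrt (x 0 ^ 3 + (A : ℝ) * x 0 + (B : ℝ))) r.domain ∧
        d = KZ.of r},
      KZ.eval c = 0 → c ∈ KZ.relations :=
  Summit.KontsevichZagierPeriods.IsogenyCertificates.XMapKernelStubs.EtaCellCollapse.stub_etaCellCollapse

/-! ### Stub 5 — the transcendence input (real periods AND quasi-periods of eggs) -/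

/-- **η-independence** (the transcendence input of the (ω,η)-cell): for finitely many three-real-root
integral cubics pairwise NOT joined by an egg-regular coprime x-rational isogeny datum, the numbers
`Ω_egg(i) = ∫_egg dx/√Pᵢ`, `H_egg(i) = ∫_egg x dx/√Pᵢ` are `ℚ`-linearly independent. Source of truth:
Wüstholz's analytic subgroup theorem in the Huber–Wüstholz dimension formula WITH quasi-periods (tree named
fact `HuberWustholzManyCurvePeriods`, HuberWustholz2022 Thm 15.3; BakerWustholz2007 Thm 6.4), Masser's CM
theorem, the twist descent for `(ω₁, η₁)` versus `(ω₂, η₂)` of quadratic twists, and the bridge "rational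
lattice multiplier between three-real-root curves ⇒ an egg-regular coprime datum in one direction" (an
isogeny not divisible by `[2]` or its dual preserves the egg). To be landed CONDITIONALLY on the named fact;
the stub itself closes only when that fact is discharged. -/
theorem stub_etaIndependence : ∀ (k : ℕ) (A B : Fin k → ℤ) (p q : Fin k → ℚ),
    (∀ i, 4 * A i ^ 3 + 27 * B i ^ 2 < 0) →
    (∀ i j, i ≠ j → ¬ ∃ (f g : ℚ[X]) (c : ℚ), IsCoprime f g ∧ derivative f * g - f * derivative g ≠ 0 ∧
      C (c ^ 2) * g * (f ^ 3 + C (A j : ℚ) * f * g ^ 2 + C (B j : ℚ) * g ^ 3) =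
        (X ^ 3 + C (A i : ℚ) * X + C (B i : ℚ)) * (derivative f * g - f * derivative g) ^ 2 ∧
      ∀ y ∈ closure ({y : ℝ | 0 < y ^ 3 + (A i : ℝ) * y + (B i : ℝ)} \
        connectedComponentIn {y : ℝ | 0 < y ^ 3 + (A i : ℝ) * y + (B i : ℝ)} (1 + |(A i : ℝ)| + |(B i : ℝ)|)),
        aeval y g ≠ 0) →
    ∑ i, ((p i : ℝ) * (∫ x in {x : Fin 1 → ℝ | x 0 ∈ {y : ℝ | 0 < y ^ 3 + (A i : ℝ) * y + (B i : ℝ)} \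
        connectedComponentIn {y : ℝ | 0 < y ^ 3 + (A i : ℝ) * y + (B i : ℝ)} (1 + |(A i : ℝ)| + |(B i : ℝ)|)},
        1 / Real.sqrt (x 0 ^ 3 + (A i : ℝ) * x 0 + (B i : ℝ))) +
      (q i : ℝ) * (∫ x in {x : Fin 1 → ℝ | x 0 ∈ {y : ℝ | 0 < y ^ 3 + (A i : ℝ) * y + (B i : ℝ)} \
        connectedComponentIn {y : ℝ | 0 < y ^ 3 + (A i : ℝ) * y + (B i : ℝ)} (1 + |(A i : ℝ)| + |(B i : ℝ)|)},
        x 0 / Real.sqrt (x 0 ^ 3 + (A i : ℝ) * x 0 + (B i : ℝ)))) = 0 →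
    ∀ i, p i = 0 ∧ q i = 0 :=
  Summit.KontsevichZagierPeriods.IsogenyCertificates.XMapKernelEtaCell.etaIndependence HuberWustholzManyCurvePeriods_holds

/-! ### Stub 6 — the ENGINE (lead): egg representations exist, and quasi-periods transfer along every
egg-regular coprime datum, in both directions -/

/-- **Quasi-period x-map transfer (the engine)**, from DD (stub 1), the weighted cell move (stub 2) and the
rational Hermite move (stub 3): (a) the egg representations `[egg(A,B), (a₀ + a₁x)/√P]` exist (bounded egg,
`(a₀ + a₁x)/√P` integrable and `ℚ`-semialgebraic); (b) for an egg-regular coprime datum `(f, g, c)` between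
three-real-root curves, with `m ≥ 1` the number of cells of the egg (each mapped by `R` onto the WHOLE target
egg, `R` being bounded on the closed egg) and `(α, β)` from DD:
`m·[egg′, (b₀ + b₁X)/√Q] ∼ [egg, |c|(b₀ + b₁R)/√P] ∼ [egg, ((|c|b₀ + b₁α/|c|) + (b₁β/|c|)x)/√P]`
(cells + rule 2; rule 1b with DD; the Hermite move kills `[egg, L(b₁S/|c|)/√P]`), whence
`[egg′, (b₀ + b₁X)/√Q] ∼ [egg, (a₀ + a₁x)/√P]` with `(a₀, a₁) = ((|c|b₀ + b₁α/|c|)/m, b₁β/(|c|m))` by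
merging `m` copies and torsion-freeness of `FormalRep ⧸ relations`; `β ≠ 0` makes `(b₀, b₁) ↦ (a₀, a₁)`
onto, which is the second direction. -/
theorem stub_quasiTransferEngine :
    (∀ (A B A' B' : ℤ) (f g : ℚ[X]) (c : ℚ),
      4 * A ^ 3 + 27 * B ^ 2 ≠ 0 → 4 * A' ^ 3 + 27 * B' ^ 2 ≠ 0 → IsCoprime f g →
      derivative f * g - f * derivative g ≠ 0 →
      C (c ^ 2) * g * (f ^ 3 + C (A' : ℚ) * f * g ^ 2 + C (B' : ℚ) * g ^ 3) =
        (X ^ 3 + C (A : ℚ) * X + C (B : ℚ)) * (derivative f * g - f * derivative g) ^ 2 →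
      ∃ α β : ℚ, β ≠ 0 ∧
        C (c ^ 2) * f * g + C 2 * (X ^ 3 + C (A : ℚ) * X + C (B : ℚ)) *
            (g * derivative (derivative g) - derivative g ^ 2) +
          derivative (X ^ 3 + C (A : ℚ) * X + C (B : ℚ)) * g * derivative g =
        (C α + C β * X) * g ^ 2) →
    (∀ (A B A' B' : ℤ) (f g : ℚ[X]) (c : ℚ),
      derivative f * g - f * derivative g ≠ 0 →
      C (c ^ 2) * g * (f ^ 3 + C (A' : ℚ) * f * g ^ 2 + C (B' : ℚ) * g ^ 3) =
        (X ^ 3 + C (A : ℚ) * X + C (B : ℚ)) * (derivative f * g - f * derivative g) ^ 2 →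
      ∀ (R W : ℝ → ℝ) (L : Set ℝ), R = (fun y => aeval y f / aeval y g) →
        W = (fun y => aeval y (derivative f * g - f * derivative g)) →
        L = {y : ℝ | 0 < y ^ 3 + (A : ℝ) * y + (B : ℝ) ∧ W y ≠ 0} →
      ∀ x₀ ∈ L, InjOn R (connectedComponentIn L x₀) → (∀ y ∈ connectedComponentIn L x₀, aeval y g ≠ 0) →
        ∀ (b₀ b₁ : ℚ) (rI t : KZ.IntegralRep 1),
          rI.domain = {x | x 0 ∈ connectedComponentIn L x₀} →
          EqOn rI.integrand (fun x => |(c : ℝ)| * ((b₀ : ℝ) + (b₁ : ℝ) * R (x 0)) /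
            Real.sqrt (x 0 ^ 3 + (A : ℝ) * x 0 + (B : ℝ))) rI.domain →
          t.domain = {x | x 0 ∈ R '' connectedComponentIn L x₀} →
          EqOn t.integrand (fun x => ((b₀ : ℝ) + (b₁ : ℝ) * x 0) /
            Real.sqrt (x 0 ^ 3 + (A' : ℝ) * x 0 + (B' : ℝ))) t.domain →
          KZ.of rI - KZ.of t ∈ KZ.relations) →
    (∀ (A B : ℤ) (u g : ℚ[X]), 4 * A ^ 3 + 27 * B ^ 2 < 0 →
      ∀ (E : Set ℝ), E = {y : ℝ | 0 < y ^ 3 + (A : ℝ) * y + (B : ℝ)} \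
        connectedComponentIn {y : ℝ | 0 < y ^ 3 + (A : ℝ) * y + (B : ℝ)} (1 + |(A : ℝ)| + |(B : ℝ)|) →
      (∀ y ∈ closure E, aeval y g ≠ 0) →
      ∀ r : KZ.IntegralRep 1, r.domain = {x | x 0 ∈ E} →
        EqOn r.integrand (fun x =>
          (2 * (x 0 ^ 3 + (A : ℝ) * x 0 + (B : ℝ)) *
              (aeval (x 0) (derivative u) * aeval (x 0) g - aeval (x 0) u * aeval (x 0) (derivative g)) +
            (3 * x 0 ^ 2 + (A : ℝ)) * aeval (x 0) u * aeval (x 0) g) /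
          (2 * (aeval (x 0) g) ^ 2 * Real.sqrt (x 0 ^ 3 + (A : ℝ) * x 0 + (B : ℝ)))) r.domain →
        KZ.of r ∈ KZ.relations) →
    (∀ (A B : ℤ) (a₀ a₁ : ℚ), 4 * A ^ 3 + 27 * B ^ 2 < 0 → ∃ r : KZ.IntegralRep 1,
      r.domain = {x | x 0 ∈ {y : ℝ | 0 < y ^ 3 + (A : ℝ) * y + (B : ℝ)} \
        connectedComponentIn {y : ℝ | 0 < y ^ 3 + (A : ℝ) * y + (B : ℝ)} (1 + |(A : ℝ)| + |(B : ℝ)|)} ∧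
      r.integrand = fun x => ((a₀ : ℝ) + (a₁ : ℝ) * x 0) / Real.sqrt (x 0 ^ 3 + (A : ℝ) * x 0 + (B : ℝ))) ∧
    (∀ (A B A' B' : ℤ), 4 * A ^ 3 + 27 * B ^ 2 < 0 → 4 * A' ^ 3 + 27 * B' ^ 2 < 0 →
      (∃ (f g : ℚ[X]) (c : ℚ), IsCoprime f g ∧ derivative f * g - f * derivative g ≠ 0 ∧
        C (c ^ 2) * g * (f ^ 3 + C (A' : ℚ) * f * g ^ 2 + C (B' : ℚ) * g ^ 3) =
          (X ^ 3 + C (A : ℚ) * X + C (B : ℚ)) * (derivative f * g - f * derivative g) ^ 2 ∧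
        ∀ y ∈ closure ({y : ℝ | 0 < y ^ 3 + (A : ℝ) * y + (B : ℝ)} \
          connectedComponentIn {y : ℝ | 0 < y ^ 3 + (A : ℝ) * y + (B : ℝ)} (1 + |(A : ℝ)| + |(B : ℝ)|)),
          aeval y g ≠ 0) →
      (∀ b₀ b₁ : ℚ, ∃ a₀ a₁ : ℚ, ∀ (r r' : KZ.IntegralRep 1),
        r.domain = {x | x 0 ∈ {y : ℝ | 0 < y ^ 3 + (A : ℝ) * y + (B : ℝ)} \
          connectedComponentIn {y : ℝ | 0 < y ^ 3 + (A : ℝ) * y + (B : ℝ)} (1 + |(A : ℝ)| + |(B : ℝ)|)} →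
        EqOn r.integrand (fun x => ((a₀ : ℝ) + (a₁ : ℝ) * x 0) /
          Real.sqrt (x 0 ^ 3 + (A : ℝ) * x 0 + (B : ℝ))) r.domain →
        r'.domain = {x | x 0 ∈ {y : ℝ | 0 < y ^ 3 + (A' : ℝ) * y + (B' : ℝ)} \
          connectedComponentIn {y : ℝ | 0 < y ^ 3 + (A' : ℝ) * y + (B' : ℝ)} (1 + |(A' : ℝ)| + |(B' : ℝ)|)} →
        EqOn r'.integrand (fun x => ((b₀ : ℝ) + (b₁ : ℝ) * x 0) /
          Real.sqrt (x 0 ^ 3 + (A' : ℝ) * x 0 + (B' : ℝ))) r'.domain →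
        KZ.Equivalent r r') ∧
      (∀ a₀ a₁ : ℚ, ∃ b₀ b₁ : ℚ, ∀ (r r' : KZ.IntegralRep 1),
        r.domain = {x | x 0 ∈ {y : ℝ | 0 < y ^ 3 + (A : ℝ) * y + (B : ℝ)} \
          connectedComponentIn {y : ℝ | 0 < y ^ 3 + (A : ℝ) * y + (B : ℝ)} (1 + |(A : ℝ)| + |(B : ℝ)|)} →
        EqOn r.integrand (fun x => ((a₀ : ℝ) + (a₁ : ℝ) * x 0) /
          Real.sqrt (x 0 ^ 3 + (A : ℝ) * x 0 + (B : ℝ))) r.domain →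
        r'.domain = {x | x 0 ∈ {y : ℝ | 0 < y ^ 3 + (A' : ℝ) * y + (B' : ℝ)} \
          connectedComponentIn {y : ℝ | 0 < y ^ 3 + (A' : ℝ) * y + (B' : ℝ)} (1 + |(A' : ℝ)| + |(B' : ℝ)|)} →
        EqOn r'.integrand (fun x => ((b₀ : ℝ) + (b₁ : ℝ) * x 0) /
          Real.sqrt (x 0 ^ 3 + (A' : ℝ) * x 0 + (B' : ℝ))) r'.domain →
        KZ.Equivalent r r')) :=
  Summit.KontsevichZagierPeriods.IsogenyCertificates.XMapKernelStubs.QuasiEngine.stub_quasiTransferEngine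

/-! ### Stub 7 — K, the remainder (GPC-strength; Disproof F1) -/

/-- **K** — reduction to the (ω, η)-egg cell modulo the enlarged move group: every kernel element is
congruent, modulo `closure gens`, to an element of the subgroup generated by the egg representations. Given
the cell theorem this is EQUIVALENT to the crux, and modulo the sibling crux `XMapPeriodTransfer` (proved) the
crux is the summit (`XMapKernel.Negative.iff_summit_of_transfer`): crux-sized, carried openly. -/
theorem stub_offCellReduction : ∀ c : KZ.FormalRep, KZ.eval c = 0 →
    ∃ c' ∈ AddSubgroup.closure {d : KZ.FormalRep | ∃ (A B : ℤ) (a₀ a₁ : ℚ) (r : KZ.IntegralRep 1),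
        4 * A ^ 3 + 27 * B ^ 2 < 0 ∧
        r.domain = {x | x 0 ∈ {y : ℝ | 0 < y ^ 3 + (A : ℝ) * y + (B : ℝ)} \
          connectedComponentIn {y : ℝ | 0 < y ^ 3 + (A : ℝ) * y + (B : ℝ)} (1 + |(A : ℝ)| + |(B : ℝ)|)} ∧
        EqOn r.integrand (fun x => ((a₀ : ℝ) + (a₁ : ℝ) * x 0) /
          Real.sqrt (x 0 ^ 3 + (A : ℝ) * x 0 + (B : ℝ))) r.domain ∧
        d = KZ.of r},
      c - c' ∈ AddSubgroup.closure Summit.KontsevichZagierPeriods.XMapKernel.Negative.gens := by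
  sorry

/-! ### Composition -/

/-- **Composition.** DD + weighted cell move + rational Hermite move ⇒ (engine) egg representations exist
and quasi-periods transfer both ways along egg-regular coprime data; with the η-independence the
(ω, η)-egg cell collapses into `KZ.relations ≤ closure gens`; K reduces every kernel element to the cell.
Concludes the crux `XMapKernel` by name. Open after registration 1: all seven stubs. -/
theorem XMapKernel_of : XMapKernel := by
  obtain ⟨hReps, hEngine⟩ :=
    stub_quasiTransferEngine stub_derivedDatum stub_weightedCellMove stub_hermiteMoveRat
  have hCell := stub_etaCellCollapse hReps hEngine stub_etaIndependence
  rw [Summit.KontsevichZagierPeriods.XMapKernel.Negative.crux_iff]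
  intro c hc
  obtain ⟨c', hc', hcc'⟩ := stub_offCellReduction c hc
  have hdiff : KZ.eval (c - c') = 0 :=
    AddMonoidHom.mem_ker.1 (Summit.KontsevichZagierPeriods.XMapKernel.Negative.closure_gens_le_ker_eval hcc')
  have hc'0 : KZ.eval c' = 0 := by
    rw [map_sub, hc, zero_sub, neg_eq_zero] at hdiff
    exact hdiff
  have hc'rel : c' ∈ KZ.relations := hCell c' hc' hc'0
  have hc'mem : c' ∈ AddSubgroup.closure Summit.KontsevichZagierPeriods.XMapKernel.Negative.gens :=
    Summit.KontsevichZagierPeriods.XMapKernel.Negative.relations_le_closure_gens hc'rel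
  have : c = (c - c') + c' := by abel
  rw [this]
  exact AddSubgroup.add_mem _ hcc' hc'mem

end Summit.KontsevichZagierPeriods.KontsevichZagierPeriods.Cruxes.XMapKernel.Lines.DerivedDatumQuasiPeriods
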